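import Mathlib
import Summits.NavierStokesRegularity.NavierStokesRegularity.Theorems.OrthantWakeDyadicBreakBelowOneGeThreeQuarters
import Summits.NavierStokesRegularity.NavierStokesRegularity.Theorems.OrthantWakeDyadicBreakBelowOneIntervalFour
import Summits.NavierStokesRegularity.NavierStokesRegularity.Theorems.OrthantWakeDyadicBreakBelowOneIntervalFive
import Summits.NavierStokesRegularity.NavierStokesRegularity.Theorems.OrthantWakeDyadicBreakBelowOneIntervalSix
import HarnessLib

/-!
# `OrthantWake.DyadicBreakBelowOne` holds for every shell ratio in `[33/20, 2]`
# (every `ε₀ ∈ [13/20, 1]`)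

Item stmt-NavierStokesRegularity-24644 (`OrthantWake.DyadicBreakBelowOne`, aside «open in print»).
Extending `not_noGlobalCascade_dyadicTable_of_ge_three_quarters` (`ε₀ ∈ [3/4, 1]`) by the eight
finer interval certificates `not_noGlobalCascade_dyadicTable_Icc_k … _r` (`ε₀ ∈ [13/20, 3/4]`,
width `1/80`, cubic 2-mode region with per-slice parameters; Bernstein certificates):

* `not_noGlobalCascade_dyadicTable_of_ge_thirteen_twentieths` — **for every `ε₀ ∈ [13/20, 1]`
  and every one-shell datum `X₀`, `¬ NoGlobalCascade ε₀ dyadicTable X₀`**: Barbato–Morandin–Romito's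
  theorem for every shell ratio `1 + ε₀ ∈ [1.65, 2]`.

This is close to the floor of the 2-mode method (`1 + ε₀ ≈ 1.62`, LEAD census memo
RUNG-BMR-RATIO, 2026-08-28); below it the item is open and needs a different idea.

HONEST FRAMING: theorems about a MODEL lattice ODE (route OrthantWake, rung TL-M2Break); nothing
here is a statement about the Navier–Stokes equations; the item (all of `(0,1)`) is not closed;
no crux or summit is proved.
-/

noncomputable section

set_option linter.dupNamespace false

namespace Summit.NavierStokesRegularity.NavierStokesRegularity.Theorems

open Set
open Literature.Analysis.FluidPDE.TaoCascade

/-- **`DyadicBreakBelowOne` on `[13/20, 1]`: for every shell ratio `1+ε₀ ∈ [33/20, 2]` and every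
one-shell datum, Theorem 4.2-level blow-up fails for the dyadic member** — case analysis over the
eight slices `…Icc_k … _r` of `[13/20, 3/4]` and `not_noGlobalCascade_dyadicTable_of_ge_three_quarters`.
MODEL lattice statement; the `ε₀ < 13/20` part of item 24644 remains open. [this file] -/
theorem not_noGlobalCascade_dyadicTable_of_ge_thirteen_twentieths {ε₀ : ℝ} (h₁ : 13 / 20 ≤ ε₀)
    (h₂ : ε₀ ≤ 1) (X₀ : Fin 4 → ℝ) : ¬ NoGlobalCascade ε₀ dyadicTable X₀ := by
  rcases le_or_gt ε₀ (53 / 80) with hk | hk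
  · exact not_noGlobalCascade_dyadicTable_Icc_k h₁ hk X₀
  rcases le_or_gt ε₀ (27 / 40) with hl | hl
  · exact not_noGlobalCascade_dyadicTable_Icc_l hk.le hl X₀
  rcases le_or_gt ε₀ (11 / 16) with hm | hm
  · exact not_noGlobalCascade_dyadicTable_Icc_m hl.le hm X₀
  rcases le_or_gt ε₀ (7 / 10) with hn | hn
  · exact not_noGlobalCascade_dyadicTable_Icc_n hm.le hn X₀
  rcases le_or_gt ε₀ (57 / 80) with ho | ho
  · exact not_noGlobalCascade_dyadicTable_Icc_o hn.le ho X₀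
  rcases le_or_gt ε₀ (29 / 40) with hp | hp
  · exact not_noGlobalCascade_dyadicTable_Icc_p ho.le hp X₀
  rcases le_or_gt ε₀ (59 / 80) with hq | hq
  · exact not_noGlobalCascade_dyadicTable_Icc_q hp.le hq X₀
  rcases le_or_gt ε₀ (3 / 4) with hr | hr
  · exact not_noGlobalCascade_dyadicTable_Icc_r hq.le hr X₀
  · exact not_noGlobalCascade_dyadicTable_of_ge_three_quarters hr.le h₂ X₀

/-- The item's shape on the certified range: `∀ ε₀ ∈ [13/20, 1), ∀ X₀, ¬ NoGlobalCascade ε₀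
dyadicTable X₀`. MODEL lattice statement. [this file] -/
theorem dyadicBreakBelowOne_of_ge_thirteen_twentieths :
    ∀ ε₀ : ℝ, 13 / 20 ≤ ε₀ → ε₀ < 1 → ∀ X₀ : Fin 4 → ℝ, ¬ NoGlobalCascade ε₀ dyadicTable X₀ :=
  fun _ h₁ h₂ X₀ => not_noGlobalCascade_dyadicTable_of_ge_thirteen_twentieths h₁ h₂.le X₀

end Summit.NavierStokesRegularity.NavierStokesRegularity.Theorems

end
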